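import Summits.MatrixMultiplication.OmegaCensus.SmallFormats.MatMul22nRankGF7Plane
import HarnessLib

/-!
# ω-census family (a): block arithmetic at pitch `2^1752` for the slack-6 search checker (K6)

Cell `pub-omega` (unit `pub-omega-tensor-g17`), topic `Summits/MatrixMultiplication/OmegaCensus` (sub-folder `SmallFormats`).
Framing (verbatim): lottery ticket; floor = certified bounds/negative ranges. HONEST FRAMING: kernel infrastructure
(`pub-omega-tensor-g17/KERNEL-S6-DESIGN.md` §2; the pitch-`1752` analogue of `MatMul22nRankGF7Plane`): the search states of the slack-6 checker
are base-`2^12` digit vectors and its relation evaluations are single multiplications whose results live in blocks of `146` digits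
(`1752` bits). Proved here, for `X = packW 1752 f n`:
* `blocks_shift_mask`: `(X >>> t) &&& laneMask12 n` reads the `12`-bit field at offset `t` of every block;
* `blocks_resid`: `X − 7·(((X·18725) >>> 17) &&& laneMask12 n)` is the block-wise residue mod `7` (blocks `< 2^14`);
* `blocks_dot`: `W * Σ_j E_j·2^(1752 j)` followed by `blocks_shift_mask` gives all dot products `Σ_i f_i e_{j,i}` at once;
* `blocks_gather7`: one multiplication by `Σ_j 7^j 2^(1752 (n−1−j))` combines block residues into `Σ_j r_j 7^j`;
* `blocks_and_sel`, `blocks_sum41`: selecting blocks by a mask and summing all blocks into block `41` (heptad sums);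
* `packW_append`, `sum_pow_lt_pow7`. Nothing here is progress on `ω`.
-/

namespace Summit.MatrixMultiplication.OmegaCensus.SmallFormats

open Finset
open Literature.NumberTheory.NumberFields (list_sum_range_map)

set_option exponentiation.threshold 100000

/-! ## The block mask -/

/-- Block mask: `2^12 − 1` at the start of each of the first `n` blocks of `1752` bits. -/
def laneMask12 (n : ℕ) : ℕ := ((List.range n).map fun j => (2 ^ 12 - 1) * 2 ^ (1752 * j)).sum

/-- The mask as a packing. -/
theorem laneMask12_eq (n : ℕ) : laneMask12 n = packW 1752 (fun _ => 2 ^ 12 - 1) n := by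
  unfold laneMask12 packW; rw [list_sum_range_map]

/-- `2^12 ≤ 2^1752`. -/
theorem two_pow_12_le_1752 : (2 : ℕ) ^ 12 ≤ 2 ^ 1752 := Nat.pow_le_pow_right (by norm_num) (by norm_num)

/-- Bits of the mask. -/
theorem testBit_laneMask12 (n i : ℕ) : (laneMask12 n).testBit i = (decide (i / 1752 < n) && decide (i % 1752 < 12)) := by
  rw [laneMask12_eq, testBit_packW (by norm_num) _ (fun _ _ => lt_of_lt_of_le (by norm_num) two_pow_12_le_1752),
    Nat.testBit_two_pow_sub_one]

/-! ## Shifting and masking -/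

/-- **Reading a 12-bit field of every block.** For `X = packW 1752 f N` (`f c < 2^1752`), `n ≤ N`, `t + 12 ≤ 1752`:
`(X >>> t) &&& laneMask12 n` is the block vector of `(f c >>> t) % 2^12`, `c < n`. -/
theorem blocks_shift_mask {f : ℕ → ℕ} {N n t : ℕ} (hf : ∀ c < N, f c < 2 ^ 1752) (hn : n ≤ N) (ht : t + 12 ≤ 1752) :
    (packW 1752 f N >>> t) &&& laneMask12 n = packW 1752 (fun c => (f c >>> t) % 2 ^ 12) n := by
  apply Nat.eq_of_testBit_eq
  intro i
  have hg : ∀ c < n, (fun c => (f c >>> t) % 2 ^ 12) c < 2 ^ 1752 :=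
    fun c _ => lt_of_lt_of_le (Nat.mod_lt _ (by norm_num)) two_pow_12_le_1752
  rw [Nat.testBit_and, Nat.testBit_shiftRight, testBit_laneMask12, testBit_packW (by norm_num) f hf,
    testBit_packW (by norm_num) _ hg]
  simp only [Nat.testBit_mod_two_pow, Nat.testBit_shiftRight]
  by_cases ho : i % 1752 < 12
  · have e1 : (t + i) / 1752 = i / 1752 := by omega
    have e2 : (t + i) % 1752 = t + i % 1752 := by omega
    rw [e1, e2]
    by_cases hc : i / 1752 < n
    · simp [ho, hc, show i / 1752 < N by omega]
    · simp [hc]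
  · simp [ho]

/-! ## Residues mod 7 -/

/-- **Block-wise residues.** For block values `v c < 2^14`:
`X − 7·(((X·18725) >>> 17) &&& laneMask12 n)` is the block vector of `v c % 7` (`X = packW 1752 v n`). -/
theorem blocks_resid {v : ℕ → ℕ} {n : ℕ} (hv : ∀ c < n, v c < 2 ^ 14) :
    packW 1752 v n - 7 * (((packW 1752 v n * 18725) >>> 17) &&& laneMask12 n) = packW 1752 (fun c => v c % 7) n := by
  have hmul : packW 1752 v n * 18725 = packW 1752 (fun c => 18725 * v c) n := by rw [packW_smul]; ring
  have hb : ∀ c < n, (fun c => 18725 * v c) c < 2 ^ 1752 := fun c hc => by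
    show 18725 * v c < 2 ^ 1752
    exact lt_of_lt_of_le (by have := hv c hc; omega : 18725 * v c < 2 ^ 29) (Nat.pow_le_pow_right (by norm_num) (by norm_num))
  rw [hmul, blocks_shift_mask hb le_rfl (by norm_num)]
  have hq : ∀ c < n, (fun c => (18725 * v c) >>> 17 % 2 ^ 12) c = v c / 7 := by
    intro c hc
    show (18725 * v c) >>> 17 % 2 ^ 12 = v c / 7
    rw [mul_comm, mulHigh7_ok (hv c hc), Nat.mod_eq_of_lt (by have := hv c hc; omega)]
  rw [packW_congr 1752 hq, ← packW_smul, packW_sub 1752 (fun c _ => Nat.mul_div_le (v c) 7)]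
  exact packW_congr 1752 fun c _ => by show v c - 7 * (v c / 7) = v c % 7; omega

/-! ## Dot products of a digit vector against several coefficient vectors at once -/

/-- Multiplying by a number distributes into the blocks. -/
theorem mul_packW (W X : ℕ) (g : ℕ → ℕ) (n : ℕ) : X * packW W g n = packW W (fun j => X * g j) n := by
  rw [packW_smul]

/-- **All dot products at once.** Let `W = packW 12 f N` with `f i ≤ 6` (`0 < N ≤ 73`) and `E = Σ_{j<n} E_j 2^(1752 j)` with
`E_j = packW 12 (k ↦ e j (N−1−k)) N`, `e j i ≤ 6`. Then `((W * E) >>> 12 (N − 1)) &&& laneMask12 n` is the block vector of the dot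
products `Σ_{i<N} f i · e j i`. -/
theorem blocks_dot {f : ℕ → ℕ} {N : ℕ} (hN : 0 < N) (hN73 : N ≤ 73) (hf : ∀ i < N, f i ≤ 6) {e : ℕ → ℕ → ℕ} {n : ℕ}
    (he : ∀ j < n, ∀ i < N, e j i ≤ 6) :
    ((packW 12 f N * packW 1752 (fun j => packW 12 (fun k => e j (N - 1 - k)) N) n) >>> (12 * (N - 1))) &&& laneMask12 n
      = packW 1752 (fun j => ∑ i ∈ range N, f i * e j i) n := by
  rw [mul_packW]
  have hWlt : packW 12 f N < 2 ^ (12 * N) := packW_lt f N fun i hi => by have := hf i hi; omega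
  have hlane : ∀ j < n, (fun j => packW 12 f N * packW 12 (fun k => e j (N - 1 - k)) N) j < 2 ^ 1752 := by
    intro j hj
    have hE : packW 12 (fun k => e j (N - 1 - k)) N < 2 ^ (12 * N) := packW_lt _ N fun k hk => by have := he j hj (N - 1 - k) (by omega); omega
    show packW 12 f N * packW 12 (fun k => e j (N - 1 - k)) N < 2 ^ 1752
    calc packW 12 f N * packW 12 (fun k => e j (N - 1 - k)) N < 2 ^ (12 * N) * 2 ^ (12 * N) :=
          Nat.mul_lt_mul_of_lt_of_le hWlt hE.le (Nat.two_pow_pos _)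
      _ = 2 ^ (12 * N + 12 * N) := (pow_add 2 _ _).symm
      _ ≤ 2 ^ 1752 := Nat.pow_le_pow_right (by norm_num) (by omega)
  rw [blocks_shift_mask hlane le_rfl (by omega)]
  refine packW_congr 1752 fun j hj => ?_
  show (packW 12 f N * packW 12 (fun k => e j (N - 1 - k)) N) >>> (12 * (N - 1)) % 2 ^ 12 = ∑ i ∈ range N, f i * e j i
  have e1 : (packW 12 f N * packW 12 (fun k => e j (N - 1 - k)) N) >>> (12 * (N - 1)) % 2 ^ 12
      = fld 12 (packW 12 f N * packW 12 (fun k => e j (N - 1 - k)) N) (N - 1) := by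
    rw [fldW_eq, Nat.shiftRight_eq_div_pow]
  rw [e1]
  exact dot_digitW (W := 12) (A := 6) (B := 6) f (e j) hN
    (lt_of_le_of_lt (Nat.mul_le_mul_right _ hN73) (by norm_num)) hf (he j hj)

/-! ## Gathering block residues into one base-7 number -/

/-- `Σ_{j<n} 6·7^j < 7^n`. -/
theorem sum_six_pow_lt (n : ℕ) : ∑ j ∈ range n, 6 * 7 ^ j < 7 ^ n := by
  induction n with
  | zero => simp
  | succ n ih => rw [sum_range_succ, pow_succ]; omega

/-- A base-7 combination of `n ≤ 15` residues is `< 2^43`. -/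
theorem sum_pow7_lt {r : ℕ → ℕ} {n : ℕ} (hn : n ≤ 15) (hr : ∀ j < n, r j ≤ 6) : ∑ j ∈ range n, r j * 7 ^ j < 2 ^ 43 :=
  calc ∑ j ∈ range n, r j * 7 ^ j ≤ ∑ j ∈ range n, 6 * 7 ^ j := sum_le_sum fun j hj => Nat.mul_le_mul_right _ (hr j (mem_range.1 hj))
    _ < 7 ^ n := sum_six_pow_lt n
    _ ≤ 7 ^ 15 := Nat.pow_le_pow_right (by norm_num) hn
    _ < 2 ^ 43 := by norm_num

/-- **Gathering.** For block residues `r j ≤ 6` (`0 < n ≤ 15`) and `G = Σ_{j<n} 7^j 2^(1752 (n−1−j))`: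
`((R * G) >>> 1752 (n−1)) % 2^43 = Σ_j r j 7^j`. -/
theorem blocks_gather7 {r : ℕ → ℕ} {n : ℕ} (hn : 0 < n) (hn15 : n ≤ 15) (hr : ∀ j < n, r j ≤ 6) :
    ((packW 1752 r n * ((List.range n).map fun j => 7 ^ j * 2 ^ (1752 * (n - 1 - j))).sum) >>> (1752 * (n - 1))) % 2 ^ 43
      = ∑ j ∈ range n, r j * 7 ^ j := by
  -- the multiplier is the reversed packing of the powers of 7
  have hG : ((List.range n).map fun j => 7 ^ j * 2 ^ (1752 * (n - 1 - j))).sum = packW 1752 (fun k => 7 ^ (n - 1 - k)) n := by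
    rw [list_sum_range_map]
    unfold packW
    rw [← sum_range_reflect (fun j => 7 ^ j * 2 ^ (1752 * (n - 1 - j))) n]
    refine sum_congr rfl fun k hk => ?_
    have hk' := mem_range.1 hk
    simp only [show n - 1 - (n - 1 - k) = k by omega]
  rw [hG]
  have hd := dot_digitW (W := 1752) (A := 6) (B := 7 ^ 14) r (fun j => 7 ^ j) hn
    (lt_of_le_of_lt (Nat.mul_le_mul_right _ hn15) (by norm_num)) hr
    (fun j hj => Nat.pow_le_pow_right (by norm_num) (by omega))
  rw [fldW_eq, ← Nat.shiftRight_eq_div_pow] at hd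
  have hlt : ∑ j ∈ range n, r j * 7 ^ j < 2 ^ 43 := sum_pow7_lt hn15 hr
  have e : ((packW 1752 r n * packW 1752 (fun i => 7 ^ (n - 1 - i)) n) >>> (1752 * (n - 1))) % 2 ^ 43
      = ((packW 1752 r n * packW 1752 (fun i => 7 ^ (n - 1 - i)) n) >>> (1752 * (n - 1))) % 2 ^ 1752 % 2 ^ 43 :=
    (Nat.mod_mod_of_dvd _ (pow_dvd_pow 2 (by norm_num : 43 ≤ 1752))).symm
  rw [e, hd, Nat.mod_eq_of_lt hlt]

/-! ## Selecting and summing blocks (heptad sums) -/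

/-- **Selecting blocks.** AND with a block vector of `2^12 − 1` / `0` keeps exactly the selected blocks (block values `< 2^12`). -/
theorem blocks_and_sel {v : ℕ → ℕ} {n : ℕ} (hv : ∀ c < n, v c < 2 ^ 12) (sel : ℕ → Bool) :
    packW 1752 v n &&& packW 1752 (fun c => if sel c then 2 ^ 12 - 1 else 0) n = packW 1752 (fun c => if sel c then v c else 0) n := by
  apply Nat.eq_of_testBit_eq
  intro i
  have hv' : ∀ c < n, v c < 2 ^ 1752 := fun c hc => lt_of_lt_of_le (hv c hc) two_pow_12_le_1752
  have hm : ∀ c < n, (fun c => if sel c then 2 ^ 12 - 1 else 0) c < 2 ^ 1752 := fun c _ => by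
    show (if sel c then 2 ^ 12 - 1 else 0) < 2 ^ 1752; split_ifs <;> norm_num
  have hs : ∀ c < n, (fun c => if sel c then v c else 0) c < 2 ^ 1752 := fun c hc => by
    show (if sel c then v c else 0) < 2 ^ 1752; split_ifs; exact hv' c hc; norm_num
  rw [Nat.testBit_and, testBit_packW (by norm_num) v hv', testBit_packW (by norm_num) _ hm, testBit_packW (by norm_num) _ hs]
  have h4095 : ∀ k, (2 ^ 12 - 1 : ℕ).testBit k = decide (k < 12) := fun k => Nat.testBit_two_pow_sub_one 12 k
  by_cases hc : i / 1752 < n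
  · simp only [hc, decide_true, Bool.true_and]
    by_cases hsel : sel (i / 1752) = true
    · simp only [hsel, if_true, h4095]
      by_cases hk : i % 1752 < 12
      · simp [hk]
      · have hlt : v (i / 1752) < 2 ^ (i % 1752) := lt_of_lt_of_le (hv _ hc) (Nat.pow_le_pow_right (by norm_num) (by omega))
        rw [Nat.testBit_lt_two_pow hlt]; simp [hk]
    · have hsel' : sel (i / 1752) = false := by simpa using hsel
      simp [hsel']
  · simp [hc]

/-- The all-ones block vector. -/
theorem ones_blocks_eq (n : ℕ) : ((List.range n).map fun k => 2 ^ (1752 * k)).sum = packW 1752 (fun _ => 1) n := by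
  unfold packW; rw [list_sum_range_map]; exact sum_congr rfl fun k _ => (one_mul _).symm

/-- **Summing all blocks.** For block values `v c ≤ 6`: block `41` of `X * ones` (42 blocks) is `Σ_{c<42} v c`. -/
theorem blocks_sum41 {v : ℕ → ℕ} (hv : ∀ c < 42, v c ≤ 6) :
    (packW 1752 v 42 * ((List.range 42).map fun k => 2 ^ (1752 * k)).sum) >>> 71832 % 2 ^ 1752 = ∑ c ∈ range 42, v c := by
  rw [ones_blocks_eq]
  have hd := dot_digitW (W := 1752) (A := 6) (B := 1) v (fun _ => 1) (N := 42) (by norm_num) (by norm_num) hv (fun _ _ => le_rfl)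
  rw [fldW_eq, ← Nat.shiftRight_eq_div_pow] at hd
  simp only [mul_one] at hd
  exact hd

/-! ## Appending digits to a state -/

/-- Splitting a packing after `N` digits. -/
theorem packW_append (W : ℕ) (f : ℕ → ℕ) (N n : ℕ) :
    packW W f (N + n) = packW W f N + packW W (fun k => f (N + k)) n * 2 ^ (W * N) := by
  unfold packW
  rw [sum_range_add, sum_mul]
  congr 1
  exact sum_congr rfl fun k _ => by rw [show W * (N + k) = W * k + W * N by ring, pow_add]; ring

end Summit.MatrixMultiplication.OmegaCensus.SmallFormats
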